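import Mathlib
import HarnessLib
import Summits.HubbardSuperconductivity.HubbardSuperconductivity.Theorems.KLProgrammeKLRegimeEngineFrameShiftMomentResponse
import Summits.HubbardSuperconductivity.HubbardSuperconductivity.Theorems.KLProgrammeKLRegimeTwoVolumeFrameMismatchResponseDoor

/-!
# K3 gen-8-FLOW (stmt 20437 `KLRegimeEngineV17F2`, stub (C), located risk «(C)-B-REP» item (β), step 1): the covariance-response door in MOMENT form for the
# COUNTERTERMED vertex `V_U + 𝒩_K` — `𝒲′_t := effAction (C₀ + t(C₁ − C₀)) (V_U + 𝒩_K)`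

Cell gate-hubbard-kl, seat p2 g12; pen ruling (R59c) («(β) next: `covResp_moment_kernel_two_sub_le` re-issued for the vertex `V_U + 𝒩_K` …»).  The moment door
p536707 `covResp_moment_kernel_two_sub_le` is typed for the purely quartic `V_U` — the representation of memo B-DOOR-LAW §2(a) whose two-leg kernel is the
uncancelled Hartree term.  k3c4-p2's `…TwoVolumeFrameMismatchResponseDoor` (p549…, value door) supplies everything the proof uses of the vertex for `V_U + 𝒩_K`:
even, no constant part, charge-scaling invariance, the selection rules and the tree identity `covRespCT_kernel_two_pairing_eq`.  Here the MOMENT form, proof =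
p536707 §3 verbatim up to the vertex (phase-weighted functional + `Literature/…/GrassmannCovarianceResponseTwoLeg.norm_apply_effAction_sub_le_of_linePath`):

* **`covRespCT_moment_kernel_two_sub_le`** — `Σ_x w(x)‖𝔉⁻¹[k⃗ ↦ 𝒲′[s₁]₂(X) − 𝒲′[s₀]₂(X)](x)‖ ≤ 12·(Σ_p‖(s₁−s₀) p‖)·N + 2·D·S²` with `N`, `S` the four- and two-leg moments of
  the COUNTERTERMED interpolated action (two-leg = the renormalised kernel once read with the tower) and `D` the symbol-difference moments.
Step 2 (the bare tadpole split off SIGNED, read by `…EngineFrameShiftDensityResponse.norm_sum_uvSymbolCT_sub_le_signed`) is the next file.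

Proofs only; `N`, `S`, `D` are hypotheses; nothing about their sizes is asserted; nothing asserts superconductivity.
References: Salmhofer 1998 §3.1 Prop. 1, §4.1; BGM 2006 §2.1 (2.36aa), §3 (3.3) [cite: BenfattoGiulianiMastropietro2006].
-/

noncomputable section

namespace Summit.HubbardSuperconductivity.HubbardSuperconductivity.Theorems.EngineV8

set_option linter.dupNamespace false -- summit = problem name (single-conjunct summit), D-0017

open Finset Literature.MathematicalPhysics.QuantumLattice Literature.Probability.LatticeModels GrassmannAlgebra
open Summit.HubbardSuperconductivity.HubbardSuperconductivity.Theorems.KLRegimeSplit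
open Summit.HubbardSuperconductivity.HubbardSuperconductivity.Theorems.TwoVolumeDefect
open scoped ComplexConjugate

variable {L M : ℕ} [NeZero L]

/-- **THE COVARIANCE RESPONSE OF THE TWO-LEG KERNEL IN MOMENT FORM, COUNTERTERMED VERTEX** (`V_U + 𝒩_K`): same statement and proof as
`covResp_moment_kernel_two_sub_le` with the one-shot action's own vertex. -/
theorem covRespCT_moment_kernel_two_sub_le (s₀ s₁ : FreqMomentum L M × Fin 2 → ℂ) (β U : ℝ) (K : TrigPolyC4v) (i : MatsubaraIdx M) (σ : Fin 2)
    {w : TorusSite 2 L → ℝ} (hw0 : ∀ x, 0 ≤ w x) (hw : ∀ x y, w (x + y) ≤ w x * w y)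
    (hZ : ∀ t ∈ Set.Icc (0 : ℝ) 1, effPartitionFn ℂ (normalCovariance L M s₀ + ((t : ℂ)) • (normalCovariance L M s₁ - normalCovariance L M s₀))
      (hubbardInteraction L M β U + counterQuadratic L M β K) ≠ 0)
    {N S D : ℝ}
    (hN : ∀ t ∈ Set.Icc (0 : ℝ) 1, ∀ A : HubbardFieldIdx L M, ∑ x, w x * ‖torusFourierInv (fun kv : TorusSite 2 L =>
      kernel ℂ (effAction ℂ (normalCovariance L M s₀ + ((t : ℂ)) • (normalCovariance L M s₁ - normalCovariance L M s₀))
        (hubbardInteraction L M β U + counterQuadratic L M β K)) 4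
        (Fin.snoc (Fin.snoc ![((((i, kv), σ), 0) : HubbardFieldIdx L M), (((i, kv), σ), 1)] (A.1, 1 - A.2) : Fin 3 → HubbardFieldIdx L M) A)) x‖ ≤ N)
    (hS : ∀ t ∈ Set.Icc (0 : ℝ) 1, ∑ x, w x * ‖torusFourierInv (fun kv : TorusSite 2 L =>
      kernel ℂ (effAction ℂ (normalCovariance L M s₀ + ((t : ℂ)) • (normalCovariance L M s₁ - normalCovariance L M s₀))
        (hubbardInteraction L M β U + counterQuadratic L M β K)) 2 ![((((i, kv), σ), 0) : HubbardFieldIdx L M), (((i, kv), σ), 1)]) x‖ ≤ S)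
    (hD : ∑ x, w x * ‖torusFourierInv (fun kv : TorusSite 2 L => s₁ ((i, kv), σ) - s₀ ((i, kv), σ)) x‖ ≤ D) :
    ∑ x, w x * ‖torusFourierInv (fun kv : TorusSite 2 L =>
        kernel ℂ (effAction ℂ (normalCovariance L M s₁) (hubbardInteraction L M β U + counterQuadratic L M β K)) 2
            ![((((i, kv), σ), 0) : HubbardFieldIdx L M), (((i, kv), σ), 1)] -
          kernel ℂ (effAction ℂ (normalCovariance L M s₀) (hubbardInteraction L M β U + counterQuadratic L M β K)) 2
            ![((((i, kv), σ), 0) : HubbardFieldIdx L M), (((i, kv), σ), 1)]) x‖ ≤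
      12 * (∑ p, ‖s₁ p - s₀ p‖) * N + 2 * D * S ^ 2 := by
  classical
  letI : LinearOrder (HubbardFieldIdx L M) := LinearOrder.lift' (Fintype.equivFin _) (Fintype.equivFin _).injective
  -- reading strings and two-leg data
  set X : TorusSite 2 L → Fin 2 → HubbardFieldIdx L M := fun kv => ![((((i, kv), σ), 0) : HubbardFieldIdx L M), (((i, kv), σ), 1)] with hX
  set R : HubbardGrassmann L M → TorusSite 2 L → ℂ := fun F kv => kernel ℂ F 2 (X kv) with hR
  set W₁ := effAction ℂ (normalCovariance L M s₁) (hubbardInteraction L M β U + counterQuadratic L M β K) with hW₁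
  set W₀ := effAction ℂ (normalCovariance L M s₀) (hubbardInteraction L M β U + counterQuadratic L M β K) with hW₀
  -- the endpoint difference and its phases
  set Rd : TorusSite 2 L → ℂ := fun x => torusFourierInv (fun kv => R W₁ kv - R W₀ kv) x with hRd
  set u : TorusSite 2 L → ℂ := fun x => conj (Rd x) / (‖Rd x‖ : ℂ) with hu
  have hu1 : ∀ x, ‖u x‖ ≤ 1 := fun x => norm_conj_div_norm_le_one (Rd x)
  -- the phase-weighted functional
  let Φ : HubbardGrassmann L M →ₗ[ℂ] ℂ :=
    { toFun := fun F => ∑ x, (w x : ℂ) * u x * torusFourierInv (R F) x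
      map_add' := fun F G => by
        rw [← sum_add_distrib]
        refine sum_congr rfl fun x _ => ?_
        rw [show R (F + G) = fun kv => R F kv + R G kv from funext fun kv => kernel_add ℂ F G 2 (X kv), torusFourierInv_add]
        ring
      map_smul' := fun c F => by
        rw [RingHom.id_apply, smul_eq_mul, mul_sum]
        refine sum_congr rfl fun x _ => ?_
        rw [show R (c • F) = fun kv => c * R F kv from funext fun kv => kernel_smul ℂ c F 2 (X kv), torusFourierInv_const_mul]
        ring }
  have hΦapply : ∀ F, Φ F = ∑ x, (w x : ℂ) * u x * torusFourierInv (R F) x := fun F => rfl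
  have hΦ1 : Φ 1 = 0 := by
    rw [hΦapply]
    refine sum_eq_zero fun x _ => ?_
    have h1 : R 1 = fun _ => 0 := funext fun kv => by
      show kernel ℂ (1 : HubbardGrassmann L M) 2 (X kv) = 0
      rw [kernel_def, iterDeriv_succ_apply, grassmannDeriv_one, map_zero, map_zero, mul_zero]
    rw [h1, show torusFourierInv (fun _ : TorusSite 2 L => (0 : ℂ)) x = 0 by simp [torusFourierInv_eq_sum_torusChar], mul_zero]
  have hΦle : ∀ F, ‖Φ F‖ ≤ ∑ x, w x * ‖torusFourierInv (R F) x‖ := fun F => by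
    rw [hΦapply]; exact norm_sum_weight_phase_mul_le hw0 hu1 _
  -- the endpoint value of `Φ` IS the weighted moment
  have hval : Φ W₁ - Φ W₀ = ((∑ x, w x * ‖Rd x‖ : ℝ) : ℂ) := by
    rw [← map_sub, hΦapply]
    push_cast
    refine sum_congr rfl fun x _ => ?_
    rw [show R (W₁ - W₀) = fun kv => R W₁ kv - R W₀ kv from funext fun kv => by
        show kernel ℂ (W₁ - W₀) 2 (X kv) = _; rw [sub_eq_add_neg, kernel_add, ← neg_one_smul ℂ W₀, kernel_smul]; ring,
      mul_assoc, show torusFourierInv (fun kv => R W₁ kv - R W₀ kv) x = Rd x from rfl, conj_div_norm_mul_self]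
  have hgoal : ∑ x, w x * ‖Rd x‖ = ‖Φ W₁ - Φ W₀‖ := by
    rw [hval, Complex.norm_real, Real.norm_of_nonneg (sum_nonneg fun x _ => mul_nonneg (hw0 x) (norm_nonneg _))]
  show ∑ x, w x * ‖Rd x‖ ≤ _
  rw [hgoal]
  have hV0 := constPart_hubbardInteraction_add_counterQuadratic (L := L) (M := M) β U K
  have hVe : hubbardInteraction L M β U + counterQuadratic L M β K ∈ evenOdd ℂ (ι := HubbardFieldIdx L M) 0 :=
    hubbardInteraction_add_counterQuadratic_mem_evenOdd_zero β U K
  refine norm_apply_effAction_sub_le_of_linePath (normalCovariance L M s₀) (normalCovariance L M s₁) hV0 hVe hZ Φ hΦ1 ?_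
  intro t ht
  have hNt := hN t ht
  have hSt := hS t ht
  rw [normalCovariance_linePath, normalCovariance_sub]
  rw [normalCovariance_linePath] at hNt hSt
  set st : FreqMomentum L M × Fin 2 → ℂ := fun p => s₀ p + (t : ℂ) * (s₁ p - s₀ p) with hst
  set W := effAction ℂ (normalCovariance L M st) (hubbardInteraction L M β U + counterQuadratic L M β K) with hW
  -- loop term
  have hloop : ‖Φ (grassmannLaplacian ℂ (normalCovariance L M fun p => s₁ p - s₀ p) W)‖ ≤ 12 * (∑ p, ‖s₁ p - s₀ p‖) * N :=
    (hΦle _).trans (covResp_moment_kernel_two_laplacian_le (fun p => s₁ p - s₀ p) W i σ hw0 hNt)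
  -- tree term: pointwise a product
  have htree : R (grassmannDerivPairing ℂ (normalCovariance L M fun p => s₁ p - s₀ p) W W) =
      fun kv => 4 * ((s₁ ((i, kv), σ) - s₀ ((i, kv), σ)) * R W kv ^ 2) := funext fun kv => by
    show kernel ℂ _ 2 (X kv) = _
    rw [hX]
    simp only
    rw [covRespCT_kernel_two_pairing_eq β U K (fun p => s₁ p - s₀ p) st ((i, kv), σ)]
    ring
  have hS0 : 0 ≤ S := (sum_nonneg fun x _ => mul_nonneg (hw0 x) (norm_nonneg _)).trans hSt
  have hD0 : 0 ≤ D := (sum_nonneg fun x _ => mul_nonneg (hw0 x) (norm_nonneg _)).trans hD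
  have htree_le : ‖(2 : ℂ)⁻¹ * Φ (grassmannDerivPairing ℂ (normalCovariance L M fun p => s₁ p - s₀ p) W W)‖ ≤ 2 * D * S ^ 2 := by
    rw [norm_mul, norm_inv, RCLike.norm_ofNat]
    have h1 := hΦle (grassmannDerivPairing ℂ (normalCovariance L M fun p => s₁ p - s₀ p) W W)
    rw [htree] at h1
    simp_rw [torusFourierInv_const_mul, norm_mul, RCLike.norm_ofNat] at h1
    have h2 := sum_mul_norm_torusFourierInv_mul_sq_le hw0 hw (fun kv : TorusSite 2 L => s₁ ((i, kv), σ) - s₀ ((i, kv), σ)) (R W)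
    have hSW : ∑ x, w x * ‖torusFourierInv (R W) x‖ ≤ S := hSt
    have h3 : ∑ x, w x * ‖torusFourierInv (fun kv : TorusSite 2 L => (s₁ ((i, kv), σ) - s₀ ((i, kv), σ)) * R W kv ^ 2) x‖ ≤ D * S ^ 2 :=
      h2.trans (mul_le_mul hD (pow_le_pow_left₀ (sum_nonneg fun x _ => mul_nonneg (hw0 x) (norm_nonneg _)) hSW 2)
        (sq_nonneg _) hD0)
    calc 2⁻¹ * ‖Φ (grassmannDerivPairing ℂ (normalCovariance L M fun p => s₁ p - s₀ p) W W)‖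
        ≤ 2⁻¹ * ∑ x, w x * (4 * ‖torusFourierInv (fun kv : TorusSite 2 L => (s₁ ((i, kv), σ) - s₀ ((i, kv), σ)) * R W kv ^ 2) x‖) :=
          mul_le_mul_of_nonneg_left h1 (by norm_num)
      _ = 2 * ∑ x, w x * ‖torusFourierInv (fun kv : TorusSite 2 L => (s₁ ((i, kv), σ) - s₀ ((i, kv), σ)) * R W kv ^ 2) x‖ := by
          rw [mul_sum, mul_sum]; exact sum_congr rfl fun x _ => by ring
      _ ≤ 2 * (D * S ^ 2) := mul_le_mul_of_nonneg_left h3 (by norm_num)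
      _ = 2 * D * S ^ 2 := by ring
  calc ‖Φ (grassmannLaplacian ℂ (normalCovariance L M fun p => s₁ p - s₀ p) W) -
        (2 : ℂ)⁻¹ * Φ (grassmannDerivPairing ℂ (normalCovariance L M fun p => s₁ p - s₀ p) W W)‖
      ≤ ‖Φ (grassmannLaplacian ℂ (normalCovariance L M fun p => s₁ p - s₀ p) W)‖ +
          ‖(2 : ℂ)⁻¹ * Φ (grassmannDerivPairing ℂ (normalCovariance L M fun p => s₁ p - s₀ p) W W)‖ := norm_sub_le _ _
    _ ≤ 12 * (∑ p, ‖s₁ p - s₀ p‖) * N + 2 * D * S ^ 2 := add_le_add hloop htree_le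


end Summit.HubbardSuperconductivity.HubbardSuperconductivity.Theorems.EngineV8

end
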